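import Summits.HodgeConjecture.HodgeConjecture.Statement
import Summits.HodgeConjecture.HodgeConjecture.Theses.RankFourFaces
import Summits.HodgeConjecture.HodgeConjecture.Theses.PadicSemiregularLift
import Summits.HodgeConjecture.HodgeConjecture.Theses.SevenfoldWeilCensus
import Summits.HodgeConjecture.HodgeConjecture.Theorems.SevenfoldWeilCensusAssembly
import Summits.HodgeConjecture.HodgeConjecture.Theorems.Ring2TransportWeilTypeExactness
import Summits.HodgeConjecture.HodgeConjecture.Theorems.Ring2DeformVariationalInputs
import Summits.HodgeConjecture.HodgeConjecture.Theorems.PadicSemiregularLiftHodgeAbelianVarietiesCMPivotConverseHolds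
import Literature.AlgebraicGeometry.HodgeTheory.HodgeConjectureIsogenyInvariance
import Literature.AlgebraicGeometry.HodgeTheory.SimplePrimeDimensionHodgeClasses
import Literature.AlgebraicGeometry.HodgeTheory.AbelianLowDimensionWeilReduction
import Literature.AlgebraicGeometry.HodgeTheory.AbelianLowDimensionWeilReductionProofs
import Literature.AlgebraicGeometry.HodgeTheory.LefschetzOneOneHolds
import Literature.AlgebraicGeometry.HodgeTheory.ComplexConjugationHolds
import Literature.AlgebraicGeometry.Milne1999.HodgeCMImpliesTateFiniteFields
import HarnessLib

/-!
# Ring 2 around `HC_CM` — the CLASS-TARGET FRAME of the atlas axis (typer 1, statement layer)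

HONEST FRAMING (page 1, verbatim in every file of this cell): research route conditional on HC_CM; not a
corollary; Q11.4-sentence-2 already refuted in dim ≥ 3.

`HC_CM` := `Theses.RankFourFaces.CMAbelianHodge` (item stmt-HodgeConjecture-3052, HC for complex abelian varieties
of CM type) is OPEN and is a HYPOTHESIS wherever it occurs below — a binder BY NAME, never a cited fact, no
summit-side copy. `HC_AV` := `Theses.PadicSemiregularLift.HodgeAbelianVarieties` (stmt-HodgeConjecture-1333), OPEN,
the top class target; `HC_AV_of_HC_CM` := `Theses.RankFourFaces.CMToAbelian` (stmt-HodgeConjecture-16267). Nothing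
here decides any of them: every theorem is ON-PATH (a consequence of `HodgeConjecture` / `HC_AV`), an EQUIVALENCE
between class targets, or HC on a class from a NAMED refereed input taken as a hypothesis (`TankeevRibet1983_…`,
`MoonenZarhin1999_…`) or from an open route item taken by name. No new named fact, no `sorry`, no `HC_CM` decl.

WHAT THIS FILE IS. The cell's third map axis (RING2-MAP `## §LEAD (gen 3)`) indexes intermediate CLASS TARGETS
by (dimension `g ≤ 7`, endomorphism type, Hodge group). This file fixes the ONE typed shape every cell is an
instance of — `HCOnClass 𝒞 := ∀ A : AbelianVariety ℂ, 𝒞 A → HodgeConjectureFor A.dim A.X` (summit spelling, all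
codimensions), with `HCAtDim g` / `HCUpToDim g` the classes `dim = g` / `dim ≤ g` — and proves:
§1 the glue every cell gets for free (ON-PATH `HC_AV → HCOnClass 𝒞`; covers; complement exhaustion; ISOGENY
CLOSURE `HCOnClass (IsogenyClosure 𝒞) ↔ HCOnClass 𝒞` = van Geemen 1994 Lemma 3.7; product descent);
§2 the DIMENSION axis (`HC_AV ↔ ∀ g, HCAtDim g`; `HCUpToDim g ↔ HCAtDim g` by padding; `HCUpToDim 3`
UNCONDITIONAL; `HCUpToDim 5 ↔ Theses.SevenfoldWeilCensus.HodgeAbelianDimLeFive` (stmt-18723), hence from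
{Moonen–Zarhin (0.1), (0.2) (refereed facts), Weil classes on Weil-type FOURFOLDS (Markman, UNREFEREED in
general; refereed for `det H = 1` and the general member when `K = ℚ(√-3)` — Schoen 1988, vG 1994 §7.1–7.2 — or
`K = ℚ(i)` — vG 1994 §7.4, Math. Z. 1996)} with NO `HC_CM`; `HCUpToDim 7` from the four items of route
`SevenfoldWeilCensus` through its PROVED assembly, NO `HC_CM`);
§3 the ENDOMORPHISM-TYPE axis: the CM column IS the hypothesis (`HCOnClass IsOfCMType ↔ HC_CM`: there `HC_CM` is
load-bearing by definition), the SIMPLE PRIME-DIMENSION column and everything isogenous to a power of such a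
variety close from Tankeev–Ribet (refereed), so rows `g = 2, 3, 5, 7` reduce to their NON-SIMPLE cells and
`HCUpToDim 7 ↔ HCUpToDim 5 ∧ HCAtDim 6 ∧ HC(non-simple sevenfolds)` modulo Tankeev–Ribet;
§4 the `HC_CM`-conditional readings of item 16267 on this axis (`CMToAbelian ↔ (HC_CM → ∀ g, HCAtDim g) ↔
∀ 𝒞, HC_CM → HCOnClass 𝒞`; under `HC_CM` every cell reduces to its non-CM part).
Atlas seats (`Theorems/Ring2Atlas*.lean`, namespace `…Ring2.Atlas`) state each OPEN cell as `HCOnClass 𝒞` and get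
the mandatory on-path lemma as `hcOnClass_of_hodgeAbelianVarieties 𝒞`.

References (bib keys): Deligne2000 (§1), vanGeemen1994HodgeAV (Lemma 3.7, Thm. 4.6, §7), MoonenZarhin1999LowDim
(Thms. 0.1, 0.2, (2.7); arXiv:math/9901113), Tankeev1983, Ribet1983, Markman2025SecantWeil = arXiv:2502.03415
(Cor. 1.6.1, UNREFEREED), arXiv:2509.23403 (Cor. 1.3, UNREFEREED), Schoen1988HodgeWeil, VoisinHodgeII2003 (proof of
Prop. 10.26), VoisinHodgeI2002 (§11.3), Milne1999 (§2, §7 (H)), Deligne1982HodgeCycles (§5 Prop. 5.1),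
Fulton1998 (Example 10.1.2), MumfordAV1970 (§19).
-/

set_option linter.dupNamespace false

noncomputable section

open CategoryTheory
open Literature.AlgebraicGeometry Literature.AlgebraicGeometry.Motives
open Literature.AlgebraicGeometry.HodgeTheory
open Literature.AlgebraicGeometry.Milne1999

namespace Summit.HodgeConjecture.HodgeConjecture.Ring2.ClassTargets

/-! ## §0 The typed shape of a class target -/

/-- **The Hodge conjecture on a class `𝒞` of complex abelian varieties** (summit spelling `HodgeConjectureFor`,
every codimension): for every complex abelian variety `A` with `𝒞 A`, `HodgeConjectureFor A.dim A.X`. The ONE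
shape of every intermediate class target `HC_<class>` of the cell. A definition (nothing asserted).
[cite: Deligne2000, §1] -/
def HCOnClass (𝒞 : AbelianVariety ℂ → Prop) : Prop :=
  ∀ A : AbelianVariety ℂ, 𝒞 A → HodgeConjectureFor A.dim A.X

/-- **HC for complex abelian varieties of dimension exactly `g`.** [cite: Deligne2000, §1] -/
def HCAtDim (g : ℕ) : Prop :=
  HCOnClass fun A ↦ A.dim = g

/-- **HC for complex abelian varieties of dimension `≤ g`.** [cite: Deligne2000, §1] -/
def HCUpToDim (g : ℕ) : Prop :=
  HCOnClass fun A ↦ A.dim ≤ g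

/-- Unfolding of `HCOnClass`. [folklore] -/
theorem hcOnClass_iff (𝒞 : AbelianVariety ℂ → Prop) :
    HCOnClass 𝒞 ↔ ∀ A : AbelianVariety ℂ, 𝒞 A → HodgeConjectureFor A.dim A.X :=
  Iff.rfl

/-- The GUARDED spelling used by route items (`IsSmoothProjective A.dim A.X →`, a provable guard:
`AbelianVariety.isSmoothProjective_holds`) is equivalent. [folklore] -/
theorem hcOnClass_iff_guarded (𝒞 : AbelianVariety ℂ → Prop) :
    HCOnClass 𝒞 ↔
      ∀ A : AbelianVariety ℂ, 𝒞 A → IsSmoothProjective A.dim A.X → HodgeConjectureFor A.dim A.X :=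
  ⟨fun h A hA _ ↦ h A hA, fun h A hA ↦ h A hA AbelianVariety.isSmoothProjective_holds⟩

/-! ## §1 Generic glue (every cell, for free) -/

section Glue

variable {𝒞 𝒟 : AbelianVariety ℂ → Prop}

/-- The class of ALL abelian varieties is `HC_AV` (item stmt-HodgeConjecture-1333, by name). [folklore] -/
theorem hcOnClass_univ_iff :
    HCOnClass (fun _ ↦ True) ↔ Theses.PadicSemiregularLift.HodgeAbelianVarieties :=
  ⟨fun h A ↦ h A trivial, fun h A _ ↦ h A⟩

/-- **ON-PATH (mandatory for every cell): `HC_AV → HC_<class>`.** [folklore] -/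
theorem hcOnClass_of_hodgeAbelianVarieties (𝒞 : AbelianVariety ℂ → Prop)
    (h : Theses.PadicSemiregularLift.HodgeAbelianVarieties) : HCOnClass 𝒞 :=
  fun A _ ↦ h A

/-- **ON-PATH from the summit: `HodgeConjecture → HC_<class>`** (through the landed
`Ring2.Deform.HC_AV_of_hodgeConjecture`). [cite: Deligne2000, §1] -/
theorem hcOnClass_of_hodgeConjecture (𝒞 : AbelianVariety ℂ → Prop) (h : _root_.HodgeConjecture) :
    HCOnClass 𝒞 :=
  hcOnClass_of_hodgeAbelianVarieties 𝒞 (Ring2.Deform.HC_AV_of_hodgeConjecture h)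

/-- Monotonicity: a target on a larger class gives the target on a smaller one. [folklore] -/
theorem hcOnClass_mono (h𝒞𝒟 : ∀ A, 𝒞 A → 𝒟 A) (h : HCOnClass 𝒟) : HCOnClass 𝒞 :=
  fun A hA ↦ h A (h𝒞𝒟 A hA)

/-- **Covers**: if every member of `𝒞` lies in some cell `𝒟 i` and every cell is closed, `𝒞` is closed (the
atlas's gluing rule). [folklore] -/
theorem hcOnClass_of_cover {ι : Sort*} (𝒟 : ι → AbelianVariety ℂ → Prop)
    (hcov : ∀ A, 𝒞 A → ∃ i, 𝒟 i A) (h : ∀ i, HCOnClass (𝒟 i)) : HCOnClass 𝒞 := by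
  intro A hA
  obtain ⟨i, hi⟩ := hcov A hA
  exact h i A hi

/-- A union of two cells. [folklore] -/
theorem hcOnClass_or_iff :
    HCOnClass (fun A ↦ 𝒞 A ∨ 𝒟 A) ↔ HCOnClass 𝒞 ∧ HCOnClass 𝒟 :=
  ⟨fun h ↦ ⟨fun A hA ↦ h A (Or.inl hA), fun A hA ↦ h A (Or.inr hA)⟩,
    fun h A hA ↦ hA.elim (h.1 A) (h.2 A)⟩

/-- A cell and its subdivision along any predicate `P`. [folklore] -/
theorem hcOnClass_iff_and_split (P : AbelianVariety ℂ → Prop) :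
    HCOnClass 𝒞 ↔ HCOnClass (fun A ↦ 𝒞 A ∧ P A) ∧ HCOnClass (fun A ↦ 𝒞 A ∧ ¬ P A) := by
  refine ⟨fun h ↦ ⟨fun A hA ↦ h A hA.1, fun A hA ↦ h A hA.1⟩, fun h A hA ↦ ?_⟩
  by_cases hP : P A
  · exact h.1 A ⟨hA, hP⟩
  · exact h.2 A ⟨hA, hP⟩

/-- **Exhaustion**: an atlas whose cells cover ALL abelian varieties and are all closed gives `HC_AV`.
[folklore] -/
theorem hodgeAbelianVarieties_of_cover {ι : Sort*} (𝒟 : ι → AbelianVariety ℂ → Prop)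
    (hcov : ∀ A, ∃ i, 𝒟 i A) (h : ∀ i, HCOnClass (𝒟 i)) :
    Theses.PadicSemiregularLift.HodgeAbelianVarieties :=
  fun A ↦ by
    obtain ⟨i, hi⟩ := hcov A
    exact h i A hi

/-- A cell together with its complement is `HC_AV`. [folklore] -/
theorem hodgeAbelianVarieties_of_hcOnClass_of_compl (h₁ : HCOnClass 𝒞) (h₂ : HCOnClass fun A ↦ ¬ 𝒞 A) :
    Theses.PadicSemiregularLift.HodgeAbelianVarieties :=
  fun A ↦ by
    by_cases hA : 𝒞 A
    · exact h₁ A hA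
    · exact h₂ A hA

/-- **The isogeny closure of a class**: `A` is isogenous to some member of `𝒞`. [cite: MumfordAV1970, §19] -/
def IsogenyClosure (𝒞 : AbelianVariety ℂ → Prop) (A : AbelianVariety ℂ) : Prop :=
  ∃ B : AbelianVariety ℂ, 𝒞 B ∧ AbelianVariety.IsIsogenous A B

/-- Every class is contained in its isogeny closure (isogeny is reflexive). [folklore] -/
theorem isogenyClosure_of_mem {A : AbelianVariety ℂ} (hA : 𝒞 A) : IsogenyClosure 𝒞 A :=
  ⟨A, hA, AbelianVariety.IsIsogenous.refl A⟩

/-- **ISOGENY CLOSURE of class targets** (van Geemen 1994 Lemma 3.7 = tree `HodgeConjectureFor.of_isIsogenous`):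
every atlas cell may be taken isogeny-closed. [cite: vanGeemen1994HodgeAV, §3.5–3.7 Lemma 3.7 (p. 236)] -/
theorem hcOnClass_isogenyClosure_iff (𝒞 : AbelianVariety ℂ → Prop) :
    HCOnClass (IsogenyClosure 𝒞) ↔ HCOnClass 𝒞 :=
  ⟨fun h A hA ↦ h A (isogenyClosure_of_mem hA),
    fun h _ ⟨B, hB, hAB⟩ ↦ HodgeConjectureFor.of_isIsogenous hAB (h B hB)⟩

/-- **Product descent**: HC on the products `A × B` (`A ∈ 𝒞`, one fixed `B`) gives HC on `𝒞` (tree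
`Ring2Transport.hodgeConjectureFor_of_prod`: `HC(A × B) ⇒ HC(A)`). [cite: Fulton1998, §10.1 Example 10.1.2] -/
theorem hcOnClass_of_prod (B : AbelianVariety ℂ)
    (h : HCOnClass fun P ↦ ∃ A : AbelianVariety ℂ, 𝒞 A ∧ P = A.prod B) : HCOnClass 𝒞 :=
  fun A hA ↦ Ring2Transport.hodgeConjectureFor_of_prod A B (h (A.prod B) ⟨A, hA, rfl⟩)

end Glue

/-! ## §2 The dimension axis -/

/-- `HC_AV` is the conjunction of its dimension rows. [folklore] -/
theorem hodgeAbelianVarieties_iff_forall_hcAtDim :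
    Theses.PadicSemiregularLift.HodgeAbelianVarieties ↔ ∀ g : ℕ, HCAtDim g :=
  ⟨fun h _ A _ ↦ h A, fun h A ↦ h A.dim A rfl⟩

/-- **`dim = g` gives `dim ≤ g`** (pad by an abelian variety of the complementary dimension and descend along
the projection; tree `Ring2Transport.forall_dim_le_of_forall_dim_eq`). [cite: VoisinHodgeI2002, §11.3]
[cite: Fulton1998, §10.1 Example 10.1.2] -/
theorem hcUpToDim_of_hcAtDim {g : ℕ} (h : HCAtDim g) : HCUpToDim g :=
  Ring2Transport.forall_dim_le_of_forall_dim_eq h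

/-- `dim ≤ g` gives `dim = g`. [folklore] -/
theorem hcAtDim_of_hcUpToDim {g : ℕ} (h : HCUpToDim g) : HCAtDim g :=
  fun A hA ↦ h A hA.le

/-- **The two dimension targets agree: `HCUpToDim g ↔ HCAtDim g`.** [cite: VoisinHodgeI2002, §11.3] -/
theorem hcUpToDim_iff_hcAtDim (g : ℕ) : HCUpToDim g ↔ HCAtDim g :=
  ⟨hcAtDim_of_hcUpToDim, hcUpToDim_of_hcAtDim⟩

/-- Monotonicity of `HCUpToDim`. [folklore] -/
theorem hcUpToDim_mono {g g' : ℕ} (hgg' : g ≤ g') (h : HCUpToDim g') : HCUpToDim g :=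
  fun A hA ↦ h A (hA.trans hgg')

/-- **Monotonicity of the rows: HC in dimension `g'` gives HC in every dimension `g ≤ g'`.**
[cite: VoisinHodgeI2002, §11.3] -/
theorem hcAtDim_mono {g g' : ℕ} (hgg' : g ≤ g') (h : HCAtDim g') : HCAtDim g :=
  hcAtDim_of_hcUpToDim (hcUpToDim_mono hgg' (hcUpToDim_of_hcAtDim h))

/-- The ladder step: `dim ≤ g + 1` is `dim ≤ g` and the row `g + 1`. [folklore] -/
theorem hcUpToDim_succ_iff (g : ℕ) : HCUpToDim (g + 1) ↔ HCUpToDim g ∧ HCAtDim (g + 1) := by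
  refine ⟨fun h ↦ ⟨hcUpToDim_mono (Nat.le_succ g) h, fun A hA ↦ h A hA.le⟩, fun h A hA ↦ ?_⟩
  rcases Nat.lt_or_ge A.dim (g + 1) with hlt | hge
  · exact h.1 A (Nat.lt_succ_iff.mp hlt)
  · exact h.2 A (le_antisymm hA hge)

/-- The guarded spelling of `HCUpToDim g` — the shape of the `dim ≤ 7` conjunct concluded by
`Theses.SevenfoldWeilCensus.Assembly` and of the residual `Theses.SevenfoldWeilCensus.HodgeAbelianDimGeEight`.
[folklore] -/
theorem hcUpToDim_iff_guarded (g : ℕ) :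
    HCUpToDim g ↔
      ∀ A : AbelianVariety ℂ, A.dim ≤ g → IsSmoothProjective A.dim A.X → HodgeConjectureFor A.dim A.X :=
  hcOnClass_iff_guarded _

/-- **Rows `g ≤ 3` are CLOSED unconditionally** (Lefschetz `(1,1)` + hard Lefschetz on threefolds; tree theorem
`hodgeConjectureFor_of_dim_le_three_holds`). [cite: VoisinHodgeII2003, §10.2.3 proof of Prop. 10.26] -/
theorem hcUpToDim_three : HCUpToDim 3 :=
  fun _ hA ↦ hodgeConjectureFor_of_dim_le_three_holds hA AbelianVariety.isSmoothProjective_holds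

/-- Rows `0, 1, 2, 3` one at a time. [cite: VoisinHodgeII2003, §10.2.3 proof of Prop. 10.26] -/
theorem hcAtDim_of_le_three {g : ℕ} (hg : g ≤ 3) : HCAtDim g :=
  hcAtDim_of_hcUpToDim (hcUpToDim_mono hg hcUpToDim_three)

/-- **Row `g ≤ 5` IS the support item `Theses.SevenfoldWeilCensus.HodgeAbelianDimLeFive`** (stmt-HodgeConjecture-18723,
by name; its body is the claim-tagged `Markman2025_hodgeClasses_algebraic_abelian_dim_le_five`, arXiv:2509.23403
Cor. 1.3, UNREFEREED; Hodge models exist unconditionally, `nonempty_hodgeModel_holds`).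
[cite: MoonenZarhin1999LowDim, Thms. 0.1–0.2; arXiv:math/9901113] -/
theorem hcUpToDim_five_iff_hodgeAbelianDimLeFive :
    HCUpToDim 5 ↔ Theses.SevenfoldWeilCensus.HodgeAbelianDimLeFive :=
  ⟨fun h A hd _ p c hc hH ↦ (h A hd).2 p c hc hH,
    fun h A hd ↦ hodgeConjectureFor_abelian_of_dim_le_five_of h A nonempty_hodgeModel_holds hd
      AbelianVariety.isSmoothProjective_holds⟩

/-- **Row `g ≤ 5` from its two printed inputs, NO `HC_CM`**: Weil classes on Weil-type abelian FOURFOLDS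
(`Markman2025_weilClasses_algebraic_abelianFourfold`, arXiv:2502.03415 Cor. 1.6.1, UNREFEREED for general `(d, δ)`;
refereed for `det H = 1` and the general member when `K = ℚ(√-3)` (Schoen 1988; van Geemen 1994 §7.1–7.2) or
`K = ℚ(i)` (van Geemen 1994 §7.4, Math. Z. 1996)) and the Moonen–Zarhin reduction (refereed fact
`MoonenZarhin1999_hodgeClasses_abelian_dim_le_five_of_weilClassesFourfolds`). [cite: MoonenZarhin1999LowDim, Thms. 0.1–0.2]
[cite: Markman2025SecantWeil, Cor. 1.6.1] [cite: Schoen1988HodgeWeil, Thm.] [cite: vanGeemen1994HodgeAV, §7.1–7.2 and §7.4] -/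
theorem hcUpToDim_five_of_weilClassesFourfolds_of_moonenZarhin
    (hW : Markman2025_weilClasses_algebraic_abelianFourfold)
    (hMZ : MoonenZarhin1999_hodgeClasses_abelian_dim_le_five_of_weilClassesFourfolds) : HCUpToDim 5 :=
  hcUpToDim_five_iff_hodgeAbelianDimLeFive.mpr (hMZ hW)

/-- **Row `g ≤ 5` from its three FINEST typed inputs, NO `HC_CM`**: Moonen–Zarhin's codimension-2 classification
facts `MoonenZarhin1999_codimTwoHodgeClasses_abelianFourfold` (Thm. 0.1) and `…_abelianFivefold` (Thm. 0.2), refereed,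
and the Weil classes on Weil-type fourfolds (Markman, UNREFEREED in general); every other input of the printed
combination is a theorem of the tree (`Markman2025_hodgeClasses_algebraic_abelian_dim_le_five_of_codimTwoFacts`). The
typed content of the atlas rows `g = 4, 5`. [cite: MoonenZarhin1999LowDim, Thms. 0.1, 0.2 and (1.9); arXiv:math/9901113]
[cite: Markman2025SecantWeil, Cor. 1.6.1] -/
theorem hcUpToDim_five_of_codimTwoFacts_of_weilClassesFourfolds
    (h01 : MoonenZarhin1999_codimTwoHodgeClasses_abelianFourfold)
    (h02 : MoonenZarhin1999_codimTwoHodgeClasses_abelianFivefold)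
    (hW : Markman2025_weilClasses_algebraic_abelianFourfold) : HCUpToDim 5 :=
  hcUpToDim_five_iff_hodgeAbelianDimLeFive.mpr
    (Markman2025_hodgeClasses_algebraic_abelian_dim_le_five_of_codimTwoFacts h01 h02 hW)

/-- **Row `g ≤ 7` from the route `SevenfoldWeilCensus`, NO `HC_CM`**: its cruxes `CodimTwoFromLowerDim` (stmt-18721),
`CodimThreeWeilGeneration` (stmt-18720), `WeilSixfolds` (stmt-2524) and the support `HodgeAbelianDimLeFive`
(stmt-18723), BY NAME and all OPEN, give `HCUpToDim 7` through the route's PROVED assembly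
`Theorems.sevenfoldWeilCensus_assembly_proof`; the atlas rows `g = 6, 7` refine the two census cruxes by
endomorphism type. [cite: MoonenZarhin1999LowDim, §2 (2.7)–(2.8) and §5; arXiv:math/9901113] -/
theorem hcUpToDim_seven_of_sevenfoldWeilCensus (h₃ : Theses.SevenfoldWeilCensus.CodimTwoFromLowerDim)
    (h₂ : Theses.SevenfoldWeilCensus.CodimThreeWeilGeneration) (h₄ : Theses.SevenfoldWeilCensus.WeilSixfolds)
    (h₅ : Theses.SevenfoldWeilCensus.HodgeAbelianDimLeFive) : HCUpToDim 7 :=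
  fun A hA ↦ Theorems.sevenfoldWeilCensus_assembly_proof h₃ h₂ h₄ h₅ A hA AbelianVariety.isSmoothProjective_holds

/-- The residual of that route in the frame's spelling: `HodgeAbelianDimGeEight ↔ HCOnClass (8 ≤ dim)`, so
`HC_AV ↔ HCUpToDim 7 ∧ HCOnClass (8 ≤ dim)`. [folklore] -/
theorem hodgeAbelianVarieties_iff_hcUpToDim_seven_and_dimGeEight :
    Theses.PadicSemiregularLift.HodgeAbelianVarieties ↔
      HCUpToDim 7 ∧ Theses.SevenfoldWeilCensus.HodgeAbelianDimGeEight := by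
  refine ⟨fun h ↦ ⟨fun A _ ↦ h A, fun A _ _ ↦ h A⟩, fun h A ↦ ?_⟩
  rcases Nat.lt_or_ge A.dim 8 with hlt | hge
  · exact h.1 A (by omega)
  · exact h.2 A hge AbelianVariety.isSmoothProjective_holds

/-! ## §3 The endomorphism-type axis: the CM column and the simple prime-dimension column -/

/-- **The CM column IS the hypothesis: `HCOnClass IsOfCMType ↔ HC_CM`** (`Milne1999.IsOfCMType A` is, symbol for
symbol, the CM clause of item stmt-HodgeConjecture-3052; the smooth-projective guard is provable): on every CM cell
of the atlas `HC_CM` is load-bearing BY DEFINITION (cf. the landed `Ring2Transport.HC_CM_iff_forall_cmHodgeHypothesisAt`).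
[cite: Milne1999, §2 p. 54 and §7 (H)] [cite: Deligne1982HodgeCycles, §5 Prop. 5.1] -/
theorem hcOnClass_cmType_iff_cmAbelianHodge :
    HCOnClass IsOfCMType ↔ Theses.RankFourFaces.CMAbelianHodge :=
  ⟨fun h A _ hA ↦ h A hA, fun h A hA ↦ h A AbelianVariety.isSmoothProjective_holds hA⟩

/-- The CM column from `HC_CM` (binder by name). [cite: Milne1999, §7 (H)] -/
theorem hcOnClass_cmType_of_hcCM (hCM : Theses.RankFourFaces.CMAbelianHodge) : HCOnClass IsOfCMType :=
  hcOnClass_cmType_iff_cmAbelianHodge.mpr hCM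

/-- **Under `HC_CM` every cell reduces to its NON-CM part** (so the atlas's honest content, given the cell's
standing hypothesis, is the non-CM locus of each row). [cite: Milne1999, §7 (H)] -/
theorem hcOnClass_iff_nonCM_of_hcCM (hCM : Theses.RankFourFaces.CMAbelianHodge) (𝒞 : AbelianVariety ℂ → Prop) :
    HCOnClass 𝒞 ↔ HCOnClass fun A ↦ 𝒞 A ∧ ¬ IsOfCMType A :=
  ⟨fun h ↦ ((hcOnClass_iff_and_split IsOfCMType).mp h).2,
    fun h ↦ (hcOnClass_iff_and_split IsOfCMType).mpr
      ⟨hcOnClass_mono (fun _ hA ↦ hA.2) (hcOnClass_cmType_of_hcCM hCM), h⟩⟩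

/-- **The SIMPLE PRIME-DIMENSION column closes from Tankeev–Ribet** (refereed; tree fact
`TankeevRibet1983_hodgeClasses_divisorial_powers_simplePrimeDimension` as a hypothesis; MZ 1999 (2.7) `B•(Xⁿ) = D•(Xⁿ)`):
rows `g = 2, 3, 5, 7` of the atlas, simple cells, every endomorphism type. [cite: MoonenZarhin1999LowDim, §2 Thm. (2.7)]
[cite: vanGeemen1994HodgeAV, Thm. 4.6] [cite: Tankeev1983, main theorem] [cite: Ribet1983, Thms. 0–3] -/
theorem hcOnClass_simple_primeDim_of_tankeevRibet
    (h : TankeevRibet1983_hodgeClasses_divisorial_powers_simplePrimeDimension) :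
    HCOnClass fun A ↦ A.IsSimple ∧ A.dim.Prime :=
  fun A hA ↦ hodgeConjectureFor_powSucc_of_tankeevRibet h A hA.2 rfl hA.1 0

/-- **… together with everything isogenous to a POWER of such a variety** (`X^{N+1} = X.powSucc N`): the isotypic
cells `A ∼ Xᵏ`, `X` simple of prime dimension. [cite: MoonenZarhin1999LowDim, §2 Thm. (2.7)] [cite: vanGeemen1994HodgeAV, Lemma 3.7, Thm. 4.6] -/
theorem hcOnClass_isogenousPowSimplePrimeDim_of_tankeevRibet
    (h : TankeevRibet1983_hodgeClasses_divisorial_powers_simplePrimeDimension) :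
    HCOnClass fun B ↦ ∃ (X : AbelianVariety ℂ) (N : ℕ),
      X.IsSimple ∧ X.dim.Prime ∧ AbelianVariety.IsIsogenous B (X.powSucc N) :=
  fun _ ⟨X, N, hs, hp, hiso⟩ ↦
    HodgeConjectureFor.of_isIsogenous hiso (hodgeConjectureFor_powSucc_of_tankeevRibet h X hp rfl hs N)

/-- **Modulo Tankeev–Ribet a prime-dimension row is its NON-SIMPLE cell**: `HCAtDim p ↔ HC(dim = p, not simple)`
for `p` prime. [cite: MoonenZarhin1999LowDim, §2 Thm. (2.7)] -/
theorem hcAtDim_prime_iff_nonsimple_of_tankeevRibet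
    (h : TankeevRibet1983_hodgeClasses_divisorial_powers_simplePrimeDimension) {p : ℕ} (hp : p.Prime) :
    HCAtDim p ↔ HCOnClass fun A ↦ A.dim = p ∧ ¬ A.IsSimple := by
  refine ⟨fun hAt ↦ ((hcOnClass_iff_and_split AbelianVariety.IsSimple).mp hAt).2, fun hns ↦ ?_⟩
  refine (hcOnClass_iff_and_split AbelianVariety.IsSimple).mpr ⟨fun A hA ↦ ?_, hns⟩
  have hpA : A.dim.Prime := by rw [hA.1]; exact hp
  exact hcOnClass_simple_primeDim_of_tankeevRibet h A ⟨hA.2, hpA⟩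

/-- Row `7` modulo Tankeev–Ribet: the non-simple sevenfolds. [cite: MoonenZarhin1999LowDim, §2 Thm. (2.7)] -/
theorem hcAtDim_seven_iff_nonsimple_of_tankeevRibet
    (h : TankeevRibet1983_hodgeClasses_divisorial_powers_simplePrimeDimension) :
    HCAtDim 7 ↔ HCOnClass fun A ↦ A.dim = 7 ∧ ¬ A.IsSimple :=
  hcAtDim_prime_iff_nonsimple_of_tankeevRibet h (by norm_num)

/-- **The whole `g ≤ 7` target on the atlas axis, modulo Tankeev–Ribet**:
`HCUpToDim 7 ↔ HCUpToDim 5 ∧ HCAtDim 6 ∧ HC(non-simple sevenfolds)`. [cite: MoonenZarhin1999LowDim, §2 Thm. (2.7)] -/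
theorem hcUpToDim_seven_iff_of_tankeevRibet
    (h : TankeevRibet1983_hodgeClasses_divisorial_powers_simplePrimeDimension) :
    HCUpToDim 7 ↔ HCUpToDim 5 ∧ HCAtDim 6 ∧ HCOnClass fun A ↦ A.dim = 7 ∧ ¬ A.IsSimple := by
  rw [hcUpToDim_succ_iff 6, hcUpToDim_succ_iff 5, hcAtDim_seven_iff_nonsimple_of_tankeevRibet h, and_assoc]

/-! ## §4 The `HC_CM`-conditional readings (binder by name; nothing decided) -/

/-- **Item stmt-HodgeConjecture-16267 on the atlas axis**: `CMToAbelian ↔ (HC_CM → every dimension row)`.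
[folklore] -/
theorem cmToAbelian_iff_forall_hcAtDim_of_hcCM :
    Theses.RankFourFaces.CMToAbelian ↔ (Theses.RankFourFaces.CMAbelianHodge → ∀ g : ℕ, HCAtDim g) :=
  ⟨fun h hCM _ A _ ↦ h hCM A AbelianVariety.isSmoothProjective_holds,
    fun h hCM A _ ↦ h hCM A.dim A rfl⟩

/-- **Item 16267 as "every class target closes under `HC_CM`"**: `CMToAbelian ↔ ∀ 𝒞, HC_CM → HCOnClass 𝒞`.
[folklore] -/
theorem cmToAbelian_iff_forall_hcOnClass_of_hcCM :
    Theses.RankFourFaces.CMToAbelian ↔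
      ∀ 𝒞 : AbelianVariety ℂ → Prop, Theses.RankFourFaces.CMAbelianHodge → HCOnClass 𝒞 :=
  ⟨fun h _ hCM A _ ↦ h hCM A AbelianVariety.isSmoothProjective_holds,
    fun h hCM A _ ↦ h (fun _ ↦ True) hCM A trivial⟩

/-- `HC_<class>_of_HC_CM` from item 16267, for any class (the generic conditional cell). [folklore] -/
theorem hcOnClass_of_cmToAbelian_of_hcCM (h : Theses.RankFourFaces.CMToAbelian)
    (hCM : Theses.RankFourFaces.CMAbelianHodge) (𝒞 : AbelianVariety ℂ → Prop) : HCOnClass 𝒞 :=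
  cmToAbelian_iff_forall_hcOnClass_of_hcCM.mp h 𝒞 hCM

/-! ## Audit: on-path summary — every target of this file follows from the summit -/

/-- Every target shape of this file is a consequence of `HodgeConjecture` (on-path; no target is claimed to
be progress); `HC_AV ↔ HC_CM ∧ CMToAbelian` is the landed
`Theorems.HodgeAbelianVarieties.CMPivot.hodgeAbelianVarieties_iff_cmAbelianHodge_and_cmToAbelian` (also
`Ring2.Hypotheses.hc_av_iff_hc_cm_and_cmToAbelian`), used by name. [cite: Deligne2000, §1] -/
theorem targets_of_hodgeConjecture (h : _root_.HodgeConjecture) (𝒞 : AbelianVariety ℂ → Prop) (g : ℕ) :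
    HCOnClass 𝒞 ∧ HCAtDim g ∧ HCUpToDim g ∧ HCOnClass (IsogenyClosure 𝒞) ∧
      Theses.RankFourFaces.CMAbelianHodge ∧ Theses.RankFourFaces.CMToAbelian :=
  ⟨hcOnClass_of_hodgeConjecture 𝒞 h, hcOnClass_of_hodgeConjecture _ h, hcOnClass_of_hodgeConjecture _ h,
    hcOnClass_of_hodgeConjecture _ h, Ring2.Deform.HC_CM_of_hodgeConjecture h,
    (Theorems.HodgeAbelianVarieties.CMPivot.hodgeAbelianVarieties_iff_cmAbelianHodge_and_cmToAbelian.mp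
      (Ring2.Deform.HC_AV_of_hodgeConjecture h)).2⟩

end Summit.HodgeConjecture.HodgeConjecture.Ring2.ClassTargets

end
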